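import Literature.AlgebraicGeometry.Resolution.HenselizedFunctionFieldsLemma55
import Literature.AlgebraicGeometry.Resolution.HenselizedFunctionFieldsBaseChangeProofs
import Literature.AlgebraicGeometry.Resolution.NormalDegreePDefectlessInseparable
import HarnessLib

/-!
# (R4) for `K(t)`, `t` residue-transcendental: the trust base after Prop. 2.18 and Prop. 3.1 (Kuhlmann 2010, §5)

Topic: `Literature/AlgebraicGeometry/Resolution` (valued function fields). Assembly layer of the
decomposition of the named fact `Kuhlmann2010StabilityRankOneResidueTranscendental`
(`GeneralizedStabilityRankOne.lean`) = F.-V. Kuhlmann, *Elimination of ramification I: The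
generalized stability theorem*, Trans. AMS 362 (2010) 5697–5727 = arXiv:1003.5678, §5,
Lemma 5.4, alternative (R4) — "`K` algebraically closed, `F = K(t)` of rank one with `t̄`
transcendental over `Kv` ⇒ `(F, F°)` is a defectless field" — along the printed proof
(pp. 18–20). `HenselizedFunctionFieldsLemma55.lean` reduced it to four named facts
(`Kuhlmann2010StabilityRankOneResidueTranscendental.of_ostrowski`): the Lemma of Ostrowski
(§2.3 (9)), the reduction of pp. 18–19 to a tower of normal extensions of degree `p` over a
finite unramified extension (`Kuhlmann2010TameTowerReduction`), Prop. 2.18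
(`Kuhlmann2010DefectUnramifiedBaseChange`) and Cor. 4.2 / Prop. 3.1
(`Kuhlmann2010NormalDegreePDefectless`). Two of these have since been discharged in the tree:

* Prop. 2.18 for finite unramified base changes — `Kuhlmann2010DefectUnramifiedBaseChange_holds`
  (`HenselizedFunctionFieldsBaseChangeProofs.lean`);
* the purely inseparable half of "By Corollary 4.2 or Proposition 3.1, this extension is
  defectless" (p. 20) — `Kuhlmann2010PurelyInseparableDegreePDefectless_holds`, so that
  `Kuhlmann2010NormalDegreePDefectless` rests on its Galois half, Cor. 4.2
  (`Kuhlmann2010GaloisDegreePDefectless`), by `Kuhlmann2010NormalDegreePDefectless.of_galois`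
  (`NormalDegreePDefectlessInseparable.lean`).

This file records the resulting trust base (PROVED assemblies, no new facts):

* `Kuhlmann2010StabilityHenselizedRationalResidueTranscendental.of_ostrowski_of_galois` — the
  henselized rational function field `K(x)^h` of rank one with a residue-transcendental generator
  over an algebraically closed `K` is a defectless field, from Ostrowski's lemma, the reduction
  of pp. 18–19 and Cor. 4.2;
* `Kuhlmann2010StabilityRankOneResidueTranscendental.of_ostrowski_of_galois` — hence (R4) for
  `K(t)`, `t` residue-transcendental, from the same three named facts:
  `Kuhlmann2010OstrowskiLemma` (§2.3 (9); [En], [R]), `Kuhlmann2010TameTowerReduction`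
  (pp. 18–19 with Lemma 2.27; [En], [H]) and `Kuhlmann2010GaloisDegreePDefectless` (Cor. 4.2,
  i.e. §4: Prop. 4.1 via the normal forms of Props. 4.12–4.13).

## Sources

* F.-V. Kuhlmann, *Elimination of ramification I: The generalized stability theorem*, Trans.
  Amer. Math. Soc. 362 (2010) 5697–5727 = arXiv:1003.5678: §2.3 ((9), Cor. 2.12, Prop. 2.18),
  §3 (Prop. 3.1), §4 (Prop. 4.1, Cor. 4.2), §5 (Lemma 5.4 (R4), proof of (R4) pp. 18–20,
  Lemma 5.5). [Kuhlmann2010]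
-/

noncomputable section

namespace Literature.AlgebraicGeometry.Resolution

universe u

/-- **`K(x)^h` (rank one, `x` residue-transcendental, `K` algebraically closed) is a defectless
field — from Ostrowski's lemma, the reduction of pp. 18–19 and Cor. 4.2.** PROVED assembly: Cor.
2.12 from Ostrowski (`Kuhlmann2010DefectlessOfResidueCharZero.of_ostrowski`), the henselization
is henselian (`Kuhlmann2010HenselizationIsHenselian_holds`), Prop. 2.18
(`Kuhlmann2010DefectUnramifiedBaseChange_holds`), Cor. 4.2 / Prop. 3.1 from Cor. 4.2
(`Kuhlmann2010NormalDegreePDefectless.of_galois`), the statement of p. 19 and Lemma 5.5 from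
these and Hensel's Lemma (`Kuhlmann2010NoImmediateExtensionRT.of_parts`,
`Kuhlmann2010FiniteExtensionInertiallyGenerated.of_parts`, `Kuhlmann2010HenselsLemma_holds`).
[cite: Kuhlmann2010, Section 5, proof of (R4) (pp. 18–20)] -/
theorem Kuhlmann2010StabilityHenselizedRationalResidueTranscendental.of_ostrowski_of_galois
    (hO : Kuhlmann2010OstrowskiLemma.{u}) (hα : Kuhlmann2010TameTowerReduction.{u})
    (hG : Kuhlmann2010GaloisDegreePDefectless.{u}) :
    Kuhlmann2010StabilityHenselizedRationalResidueTranscendental.{u} :=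
  Kuhlmann2010StabilityHenselizedRationalResidueTranscendental.of_parts
    (Kuhlmann2010DefectlessOfResidueCharZero.of_ostrowski hO)
    Kuhlmann2010HenselizationIsHenselian_holds hα Kuhlmann2010DefectUnramifiedBaseChange_holds
    (Kuhlmann2010NormalDegreePDefectless.of_galois hG)
    (Kuhlmann2010FiniteExtensionInertiallyGenerated.of_parts
      (Kuhlmann2010NoImmediateExtensionRT.of_parts hα Kuhlmann2010DefectUnramifiedBaseChange_holds
        (Kuhlmann2010NormalDegreePDefectless.of_galois hG))
      Kuhlmann2010HenselsLemma_holds)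

/-- **(R4) for `K(t)`, `t` residue-transcendental (`Kuhlmann2010StabilityRankOneResidueTranscendental`)
from three named facts: Ostrowski's lemma (§2.3 (9)), the reduction of pp. 18–19
(`Kuhlmann2010TameTowerReduction`) and Cor. 4.2 (`Kuhlmann2010GaloisDegreePDefectless`)** —
Thm. 2.14, §1.1 (henselization henselian, Hensel's Lemma), Lemma 2.2, Cor. 2.12, Lemma 2.13,
Prop. 2.18 (finite unramified case), Lemma 2.27 (as used), Prop. 3.1 (as used on p. 20), the
statement of p. 19, Lemma 5.5 and the induction of p. 20 all being PROVED in the tree.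
[cite: Kuhlmann2010, Section 5, Lemma 5.4 (R4) and proof of (R4) (pp. 18–20)] -/
theorem Kuhlmann2010StabilityRankOneResidueTranscendental.of_ostrowski_of_galois
    (hO : Kuhlmann2010OstrowskiLemma.{u}) (hα : Kuhlmann2010TameTowerReduction.{u})
    (hG : Kuhlmann2010GaloisDegreePDefectless.{u}) :
    Kuhlmann2010StabilityRankOneResidueTranscendental.{u} :=
  Kuhlmann2010StabilityRankOneResidueTranscendental.of_ostrowski hO hα
    Kuhlmann2010DefectUnramifiedBaseChange_holds (Kuhlmann2010NormalDegreePDefectless.of_galois hG)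

end Literature.AlgebraicGeometry.Resolution
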